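import Summits.AnomalousDissipation.AnomalousDissipation.Theorems.MarginalStabilityChainStrainedLayerLawStubVorticityUniformBoundsF
import Summits.AnomalousDissipation.AnomalousDissipation.Theorems.MarginalStabilityChainStrainedLayerLawStubVorticityUniformBoundsG
import Mathlib.Analysis.Calculus.ParametricIntegral

/-!
# Stub `stub_vorticityUniformBounds` (crux stmt-AnomalousDissipation-3007, line `strain-work-sum-rule`) — tools L:
# the time derivative of the weighted enstrophy and the cut-off enstrophy inequality

Support file (`--supports stmt-AnomalousDissipation-3007`; registered sub-goal `stub_vorticityUniformBounds_enstrophySlice`).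
* `kato_hasDerivAt_enstrophy`: `d/dt ∫∫ ω(t)²θ = 2∫∫ ω θ (∂ₓ∂ₜv − ∂_y∂ₜu)` for a bounded `C¹` weight of compact `y`-support
  (differentiation under the integral sign; the dominating function from the continuity of `ω`, `∂ₜω` on compacts);
* `stub_vorticityUniformBounds_enstrophySlice`: along a solution, with `f = ω(t)ψ` (cutoff `ψ`, `|ψ′| ≤ D` on
  `R ≤ |y| ≤ 2R`) and tails `SliceTails C k`:
  `2∫∫ ωψ²(∂ₓ∂ₜv − ∂_y∂ₜu) ≤ ‖f‖₂² − ν‖∇f‖₂² + D·C²·(2∫∫(C + |y|)e^{−k|y|} + 2νD∫∫e^{−k|y|} + 4ν∫∫e^{−k|y|})`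
  (tools G with `θ = ψ²`, `|∇f|² ≤ 2|∇ω|²ψ² + 2ω²ψ′²`).
All `[folklore]`.
-/

-- `Summit.<Summit>.<Problem>` is the tree's mandated summit-side namespace (CONVENTIONS §2); for this
-- single-conjunct summit the two coincide, so the duplicate is deliberate.
set_option linter.dupNamespace false

noncomputable section

open scoped Topology ENNReal
open Filter Set Function MeasureTheory

namespace Summit.AnomalousDissipation.AnomalousDissipation.Theorems.StrainedLayerLaw.StrainWorkSumRule

open Literature.Analysis.FluidPDE Literature.Analysis.FluidPDE.StretchedLayer
open Summit.AnomalousDissipation.AnomalousDissipation.Theorems.MarginalStabilityChainStretchedVortexRows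

/-! ## The time derivative of the weighted enstrophy -/

section EnstrophyTime

/-- **Differentiation under the integral sign for the weighted enstrophy.** For `u, v` jointly `C²` on
`(0,∞) × ℝ²`, a `C¹` weight `θ` with `|θ| ≤ 1` vanishing for `|y| ≥ R′`, and `0 < lo < t < hi`:
`d/dt ∫∫ ω(t)² θ = 2∫∫ ω(t) θ (∂ₓ∂ₜv − ∂_y∂ₜu)` (`ω` and `∂ₜω` are continuous on `(0,∞) × ℝ²`, hence bounded on
`[lo, hi] × [0, L] × [−R′, R′]`). [folklore] -/
theorem kato_hasDerivAt_enstrophy {u v : ℝ → ℝ → ℝ → ℝ}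
    (hu : ContDiffOn ℝ 2 (fun q : ℝ × ℝ × ℝ => u q.1 q.2.1 q.2.2) (Ioi 0 ×ˢ univ))
    (hv : ContDiffOn ℝ 2 (fun q : ℝ × ℝ × ℝ => v q.1 q.2.1 q.2.2) (Ioi 0 ×ˢ univ))
    {θ : ℝ → ℝ} (hθ : ContDiff ℝ 1 θ) (hθ1 : ∀ y, |θ y| ≤ 1) {R' : ℝ} (hθ0 : ∀ y, R' ≤ |y| → θ y = 0)
    (L : ℝ) {lo hi t : ℝ} (hlo : 0 < lo) (ht : t ∈ Ioo lo hi) :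
    HasDerivAt (fun s => ∫ q in Ioc 0 L ×ˢ univ, vorticity (u s) (v s) q.1 q.2 ^ 2 * θ q.2)
      (2 * ∫ q in Ioc 0 L ×ˢ univ, vorticity (u t) (v t) q.1 q.2 * θ q.2 *
        (dX (fun x y => deriv (fun s => v s x y) t) q.1 q.2 - dY (fun x y => deriv (fun s => u s x y) t) q.1 q.2))
      t := by
  have ht0 : 0 < t := hlo.trans ht.1
  have hpos : ∀ {s : ℝ}, s ∈ Ioo lo hi → 0 < s := fun hs => hlo.trans hs.1
  have hSm : MeasurableSet (Ioc (0:ℝ) L ×ˢ (univ : Set ℝ)) := measurableSet_Ioc.prod MeasurableSet.univ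
  set Ψ : ℝ × ℝ × ℝ → ℝ := fun q => dX (fun x y => deriv (fun s => v s x y) q.1) q.2.1 q.2.2 -
    dY (fun x y => deriv (fun s => u s x y) q.1) q.2.1 q.2.2 with hΨ
  set W : ℝ × ℝ × ℝ → ℝ := fun q => vorticity (u q.1) (v q.1) q.2.1 q.2.2 with hW
  have hΨc : ContinuousOn Ψ (Ioi 0 ×ˢ univ) := kato_continuousOn_vorticity_time hu hv
  have hWc : ContinuousOn W (Ioi 0 ×ˢ univ) := kato_continuousOn_vorticity_spacetime hu hv
  have hK : IsCompact (Icc lo hi ×ˢ (Icc (0:ℝ) L ×ˢ Icc (-R') R')) :=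
    isCompact_Icc.prod (isCompact_Icc.prod isCompact_Icc)
  have hKO : Icc lo hi ×ˢ (Icc (0:ℝ) L ×ˢ Icc (-R') R') ⊆ Ioi (0:ℝ) ×ˢ (univ : Set (ℝ × ℝ)) :=
    fun q hq => ⟨hlo.trans_le hq.1.1, mem_univ _⟩
  obtain ⟨M, hM⟩ := hK.exists_bound_of_continuousOn (hΨc.mono hKO)
  obtain ⟨N, hN⟩ := hK.exists_bound_of_continuousOn (hWc.mono hKO)
  have hM'0 : 0 ≤ max M 0 := le_max_right _ _
  have hN'0 : 0 ≤ max N 0 := le_max_right _ _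
  have cω : ∀ {s : ℝ}, 0 < s → Continuous fun q : ℝ × ℝ => vorticity (u s) (v s) q.1 q.2 := fun hs =>
    (contDiff_one_vorticity (contDiff_slice hu (mem_Ioi.2 hs)) (contDiff_slice hv (mem_Ioi.2 hs))).continuous
  have cθ : Continuous θ := hθ.continuous
  have cΨt : Continuous fun q : ℝ × ℝ => Ψ (t, q) :=
    hΨc.comp_continuous (continuous_const.prodMk continuous_id) fun q => ⟨ht0, mem_univ _⟩
  have hw1 : ∀ y : ℝ, |y| < R' → 1 ≤ Real.exp R' * Real.exp (-1 * |y|) := fun y hy => by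
    rw [← Real.exp_add]; exact Real.one_le_exp (by linarith)
  have key := hasDerivAt_integral_of_dominated_loc_of_deriv_le (μ := volume.restrict (Ioc 0 L ×ˢ univ))
    (F := fun s q => vorticity (u s) (v s) q.1 q.2 ^ 2 * θ q.2)
    (F' := fun s q => 2 * (vorticity (u s) (v s) q.1 q.2 * θ q.2 * Ψ (s, q)))
    (bound := fun q => 2 * max N 0 * max M 0 * Real.exp R' * Real.exp (-1 * |q.2|)) (Ioo_mem_nhds ht.1 ht.2)
    ?_ ?_ ?_ ?_ ?_ ?_
  · have h := key.2
    rw [integral_const_mul] at h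
    exact h
  · filter_upwards [Ioo_mem_nhds ht.1 ht.2] with s hs
    exact (((cω (hpos hs)).pow 2).mul (cθ.comp continuous_snd)).aestronglyMeasurable
  · exact kato_integrableOn_strip_of_eq_zero (R := R') (((cω ht0).pow 2).mul (cθ.comp continuous_snd))
      fun x _ y hy => by simp only [hθ0 y hy, mul_zero]
  · exact (continuous_const.mul ((((cω ht0)).mul (cθ.comp continuous_snd)).mul cΨt)).aestronglyMeasurable
  · refine ae_restrict_of_forall_mem hSm ?_
    rintro ⟨x, y⟩ ⟨hx, -⟩ s hs
    rw [Real.norm_eq_abs]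
    by_cases hy : R' ≤ |y|
    · simp only [hθ0 y hy, mul_zero, zero_mul, abs_zero]; positivity
    · push Not at hy
      have hq : ((s, x, y) : ℝ × ℝ × ℝ) ∈ Icc lo hi ×ˢ (Icc (0:ℝ) L ×ˢ Icc (-R') R') :=
        ⟨⟨hs.1.le, hs.2.le⟩, ⟨hx.1.le, hx.2⟩, abs_le.1 hy.le⟩
      have h1 : |Ψ (s, x, y)| ≤ max M 0 := (Real.norm_eq_abs _ ▸ hM _ hq).trans (le_max_left _ _)
      have h2 : |vorticity (u s) (v s) x y| ≤ max N 0 := (Real.norm_eq_abs _ ▸ hN _ hq).trans (le_max_left _ _)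
      have h3 := hθ1 y
      rw [abs_mul, abs_mul, abs_mul, abs_two]
      calc 2 * (|vorticity (u s) (v s) x y| * |θ y| * |Ψ (s, x, y)|) ≤ 2 * (max N 0 * 1 * max M 0) :=
            mul_le_mul_of_nonneg_left (mul_le_mul (mul_le_mul h2 h3 (abs_nonneg _) hN'0) h1 (abs_nonneg _)
              (by positivity)) zero_le_two
        _ = 2 * max N 0 * max M 0 * 1 := by ring
        _ ≤ 2 * max N 0 * max M 0 * (Real.exp R' * Real.exp (-1 * |y|)) :=
            mul_le_mul_of_nonneg_left (hw1 y hy) (by positivity)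
        _ = 2 * max N 0 * max M 0 * Real.exp R' * Real.exp (-1 * |y|) := by ring
  · show IntegrableOn (fun q : ℝ × ℝ => 2 * max N 0 * max M 0 * Real.exp R' * Real.exp (-1 * |q.2|)) (Ioc 0 L ×ˢ univ)
    refine integrableOn_strip_of_abs_le_exp (C := 2 * max N 0 * max M 0 * Real.exp R') (k := 1) (by fun_prop)
      (by positivity) one_pos fun x _ y => ?_
    rw [abs_of_nonneg (by positivity)]
  · refine ae_restrict_of_forall_mem hSm ?_
    rintro ⟨x, y⟩ - s hs
    have hω := stub_vorticityUniformBounds_vorticityTime hu hv (hpos hs) x y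
    have h := (hω.mul hω).mul_const (θ y)
    have e : (fun s => vorticity (u s) (v s) x y ^ 2 * θ y) = fun s =>
        vorticity (u s) (v s) x y * vorticity (u s) (v s) x y * θ y := funext fun s => by rw [sq]
    rw [e]
    refine h.congr_deriv ?_
    simp only [hΨ]
    ring

end EnstrophyTime

/-! ## The enstrophy dissipation inequality at one instant, with cutoff -/

section EnstrophySlice

variable {ν L : ℝ} {u v p : ℝ → ℝ → ℝ → ℝ}

/-- **The cut-off enstrophy inequality along a solution.** At time `t > 0`, for the cutoff `ψ` (`C¹`, `|ψ| ≤ 1`,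
`|ψ′| ≤ D`, `ψ′` supported in `|y| ≤ 2R`, `R ≥ 1`) and shear tails `SliceTails C k` at time `t`:
with `f = ω(t)ψ`, `F₂ = ∫∫ f²`, `P_f = ∫∫ |∇f|²`,
`2∫∫ ωψ² (∂ₓ∂ₜv − ∂_y∂ₜu) ≤ F₂ − ν P_f + D·C²·(2∫∫(C + |y|)e^{−k|y|} + 2νD∫∫e^{−k|y|} + 4ν∫∫e^{−k|y|})`
(weighted enstrophy balance of tools K with `θ = ψ²`, `|∇f|² ≤ 2|∇ω|²ψ² + 2ω²ψ′²`, and the tails on the three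
error terms). [folklore] -/
theorem stub_vorticityUniformBounds_enstrophySlice {ν L : ℝ} {u v p : ℝ → ℝ → ℝ → ℝ}
    (hsol : IsStretchedLayerNSSolutionOn (Ioi 0) ν 1 1 L u v p) (hν : 0 ≤ ν)
    (hL : 0 < L) {t : ℝ} (ht : 0 < t) {C k : ℝ} (hk : 0 < k) (hT : SliceTails C k (u t) (v t))
    {ψ : ℝ → ℝ} (hψ : ContDiff ℝ 1 ψ) (hψ1 : ∀ y, |ψ y| ≤ 1) {R D : ℝ}
    (hψR : ∀ y, 2 * R ≤ |y| → ψ y = 0) (hψ'b : ∀ y, |deriv ψ y| ≤ D) (hψ'0 : ∀ y, 2 * R < |y| → deriv ψ y = 0) :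
    2 * ∫ q in Ioc 0 L ×ˢ univ, vorticity (u t) (v t) q.1 q.2 * ψ q.2 ^ 2 *
        (dX (fun x y => deriv (fun s => v s x y) t) q.1 q.2 - dY (fun x y => deriv (fun s => u s x y) t) q.1 q.2) ≤
      (∫ q in Ioc 0 L ×ˢ univ, (vorticity (u t) (v t) q.1 q.2 * ψ q.2) ^ 2) -
        ν * (∫ q in Ioc 0 L ×ˢ univ, (dX (fun x y => vorticity (u t) (v t) x y * ψ y) q.1 q.2 ^ 2 +
          dY (fun x y => vorticity (u t) (v t) x y * ψ y) q.1 q.2 ^ 2)) +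
        D * C ^ 2 * (2 * (∫ q in Ioc 0 L ×ˢ univ, (C + |q.2|) * Real.exp (-k * |q.2|)) +
          2 * ν * D * (∫ q in Ioc 0 L ×ˢ univ, Real.exp (-k * |q.2|)) +
          4 * ν * ∫ q in Ioc 0 L ×ˢ univ, Real.exp (-k * |q.2|)) := by
  have ht' : t ∈ Ioi (0:ℝ) := ht
  have hC : 0 ≤ C := hT.nonneg
  set ω : ℝ → ℝ → ℝ := vorticity (u t) (v t) with hωdef
  have hu2 := hsol.contDiff_u ht'; have hv2 := hsol.contDiff_v ht'
  have hdiv := hsol.divFree t ht'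
  have hω1 : ContDiff ℝ 1 (fun q : ℝ × ℝ => ω q.1 q.2) := contDiff_one_vorticity hu2 hv2
  have cω : Continuous fun q : ℝ × ℝ => ω q.1 q.2 := hω1.continuous
  have cωx : Continuous fun q : ℝ × ℝ => dX ω q.1 q.2 := continuous_dX hω1
  have cωy : Continuous fun q : ℝ × ℝ => dY ω q.1 q.2 := continuous_dY hω1
  have cv : Continuous fun q : ℝ × ℝ => v t q.1 q.2 := hv2.continuous
  have cψ : Continuous ψ := hψ.continuous
  have cψ' : Continuous (deriv ψ) := hψ.continuous_deriv le_rfl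
  have hψ'0' : ∀ y, 2 * R + 1 ≤ |y| → deriv ψ y = 0 := fun y hy => hψ'0 y (by linarith)
  -- the weighted balance with `θ = ψ²`
  have hθ : ContDiff ℝ 1 (fun y => ψ y ^ 2) := hψ.pow 2
  have hθR : ∀ y, 2 * R ≤ |y| → ψ y ^ 2 = 0 := fun y hy => by rw [hψR y hy]; ring
  have hθd : ∀ y, deriv (fun y => ψ y ^ 2) y = 2 * ψ y * deriv ψ y := fun y => by
    have h := (hψ.differentiable one_ne_zero y).hasDerivAt
    have h2 : HasDerivAt (fun y => ψ y * ψ y) (deriv ψ y * ψ y + ψ y * deriv ψ y) y := h.mul h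
    have e : (fun y => ψ y ^ 2) = fun y => ψ y * ψ y := funext fun y => sq _
    rw [e, h2.deriv]; ring
  have key := stub_vorticityUniformBounds_enstrophyStatic L ν (2 * R) (u t) (v t) (p t)
    (fun x y => deriv (fun s => u s x y) t) (fun x y => deriv (fun s => v s x y) t) (fun y => ψ y ^ 2) hL
    hu2 hv2 (hsol.contDiff_p ht')
    (kato_contDiff_deriv_time_slice hsol.contDiffOn_u ht) (kato_contDiff_deriv_time_slice hsol.contDiffOn_v ht)
    (fun x y => by
      have h := hsol.momentum_x t ht' x y
      rw [dT_of_isOpen isOpen_Ioi u ht', one_mul] at h; exact h)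
    (fun x y => by
      have h := hsol.momentum_y t ht' x y
      rw [dT_of_isOpen isOpen_Ioi v ht', one_mul, one_mul] at h; exact h)
    hdiv (hsol.periodic_u t ht') (hsol.periodic_v t ht') (hsol.periodic_p t ht')
    (fun x y => kato_deriv_time_periodic (fun s hs x y => hsol.periodic_v s hs x y) ht x y) hθ hθR
  simp only [hθd] at key
  rw [key]
  -- notation for the pieces
  set F₂ : ℝ := ∫ q in Ioc 0 L ×ˢ univ, (ω q.1 q.2 * ψ q.2) ^ 2 with hF₂
  set Pf : ℝ := ∫ q in Ioc 0 L ×ˢ univ, (dX (fun x y => ω x y * ψ y) q.1 q.2 ^ 2 +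
    dY (fun x y => ω x y * ψ y) q.1 q.2 ^ 2) with hPf
  set Pt : ℝ := ∫ q in Ioc 0 L ×ˢ univ, (dX ω q.1 q.2 ^ 2 + dY ω q.1 q.2 ^ 2) * ψ q.2 ^ 2 with hPt
  set E₁ : ℝ := ∫ q in Ioc 0 L ×ˢ univ, ω q.1 q.2 ^ 2 * deriv ψ q.2 ^ 2 with hE₁
  set E₂ : ℝ := ∫ q in Ioc 0 L ×ˢ univ, ω q.1 q.2 ^ 2 * (v t q.1 q.2 - q.2) * (2 * ψ q.2 * deriv ψ q.2) with hE₂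
  set E₃ : ℝ := ∫ q in Ioc 0 L ×ˢ univ, ω q.1 q.2 * dY ω q.1 q.2 * (2 * ψ q.2 * deriv ψ q.2) with hE₃
  set IW : ℝ := ∫ q in Ioc 0 L ×ˢ univ, (C + |q.2|) * Real.exp (-k * |q.2|) with hIW
  set Ik : ℝ := ∫ q in Ioc 0 L ×ˢ univ, Real.exp (-k * |q.2|) with hIk
  -- `∫∫ ω²ψ² = F₂`
  have eF : ∫ q in Ioc 0 L ×ˢ univ, ω q.1 q.2 ^ 2 * ψ q.2 ^ 2 = F₂ := by
    simp only [hF₂]; exact integral_congr_ae (Eventually.of_forall fun q => by simp only; ring)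
  -- `Pf ≤ 2Pt + 2E₁`
  have hωx : ∀ x y, HasDerivAt (fun s => ω s y) (dX ω x y) x := hasDerivAt_dX_of_contDiff hω1 one_ne_zero
  have hωy : ∀ x y, HasDerivAt (fun s => ω x s) (dY ω x y) y := hasDerivAt_dY_of_contDiff hω1 one_ne_zero
  have hψd : ∀ y, HasDerivAt ψ (deriv ψ y) y := fun y => (hψ.differentiable one_ne_zero y).hasDerivAt
  have hfx : ∀ x y, dX (fun x y => ω x y * ψ y) x y = dX ω x y * ψ y := fun x y => ((hωx x y).mul_const (ψ y)).deriv
  have hfy : ∀ x y, dY (fun x y => ω x y * ψ y) x y = dY ω x y * ψ y + ω x y * deriv ψ y := fun x y =>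
    ((hωy x y).mul (hψd y)).deriv
  have iψ2 : ∀ F : ℝ × ℝ → ℝ, Continuous F → IntegrableOn (fun q : ℝ × ℝ => F q * ψ q.2 ^ 2) (Ioc 0 L ×ˢ univ) :=
    fun F hF => kato_integrableOn_strip_of_eq_zero (R := 2 * R) (hF.mul ((cψ.comp continuous_snd).pow 2))
      fun x _ y hy => by simp only [hψR y hy]; ring
  have iψ' : ∀ F : ℝ × ℝ → ℝ, Continuous F → IntegrableOn (fun q : ℝ × ℝ => F q * deriv ψ q.2) (Ioc 0 L ×ˢ univ) :=
    fun F hF => kato_integrableOn_strip_of_eq_zero (R := 2 * R + 1) (hF.mul (cψ'.comp continuous_snd))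
      fun x _ y hy => by simp only [hψ'0' y hy, mul_zero]
  have iPt : IntegrableOn (fun q : ℝ × ℝ => (dX ω q.1 q.2 ^ 2 + dY ω q.1 q.2 ^ 2) * ψ q.2 ^ 2) (Ioc 0 L ×ˢ univ) :=
    iψ2 _ (by fun_prop)
  have iE₁ : IntegrableOn (fun q : ℝ × ℝ => ω q.1 q.2 ^ 2 * deriv ψ q.2 ^ 2) (Ioc 0 L ×ˢ univ) := by
    have := iψ' (fun q => ω q.1 q.2 ^ 2 * deriv ψ q.2) (by fun_prop)
    exact this.congr_fun (fun q _ => by simp only; ring) (measurableSet_Ioc.prod MeasurableSet.univ)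
  have iPf : IntegrableOn (fun q : ℝ × ℝ => dX (fun x y => ω x y * ψ y) q.1 q.2 ^ 2 +
      dY (fun x y => ω x y * ψ y) q.1 q.2 ^ 2) (Ioc 0 L ×ˢ univ) := by
    have h1 := iψ2 (fun q => dX ω q.1 q.2 ^ 2) (by fun_prop)
    have h2 := iψ2 (fun q => dY ω q.1 q.2 ^ 2) (by fun_prop)
    have h3 := iψ' (fun q => 2 * dY ω q.1 q.2 * ψ q.2 * ω q.1 q.2) (by fun_prop)
    have h4 := iψ' (fun q => ω q.1 q.2 ^ 2 * deriv ψ q.2) (by fun_prop)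
    have h : IntegrableOn (fun q : ℝ × ℝ => dX ω q.1 q.2 ^ 2 * ψ q.2 ^ 2 + dY ω q.1 q.2 ^ 2 * ψ q.2 ^ 2 +
        2 * dY ω q.1 q.2 * ψ q.2 * ω q.1 q.2 * deriv ψ q.2 + ω q.1 q.2 ^ 2 * deriv ψ q.2 * deriv ψ q.2)
        (Ioc 0 L ×ˢ univ) := ((h1.add h2).add h3).add h4
    refine h.congr_fun (fun q _ => ?_) (measurableSet_Ioc.prod MeasurableSet.univ)
    simp only; rw [hfx, hfy]; ring
  have hPf_le : Pf ≤ 2 * Pt + 2 * E₁ := by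
    simp only [hPf, hPt, hE₁]
    rw [← integral_const_mul, ← integral_const_mul, ← integral_add (iPt.const_mul 2) (iE₁.const_mul 2)]
    refine integral_mono iPf ((iPt.const_mul 2).add (iE₁.const_mul 2)) fun q => ?_
    simp only
    rw [hfx, hfy]
    nlinarith [sq_nonneg (dY ω q.1 q.2 * ψ q.2 - ω q.1 q.2 * deriv ψ q.2), sq_nonneg (dX ω q.1 q.2 * ψ q.2)]
  -- tails bounds for the three error terms
  have hωb : ∀ x y, |ω x y| ≤ C * Real.exp (-k * |y|) := tails_abs_vorticity_le hT
  have hωyb : ∀ x y, |dY ω x y| ≤ C * Real.exp (-k * |y|) := kato_abs_dY_vorticity_le hT hu2 hv2 hdiv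
  have hle1 : ∀ y : ℝ, Real.exp (-k * |y|) ≤ 1 := fun y => Real.exp_le_one_iff.2 (by nlinarith [abs_nonneg y])
  have hω2b : ∀ x y, ω x y ^ 2 ≤ C ^ 2 * Real.exp (-k * |y|) := fun x y => by
    have h1 := hωb x y
    have h2 : |ω x y| ≤ C := h1.trans (by nlinarith [hle1 y])
    calc ω x y ^ 2 = |ω x y| * |ω x y| := by rw [← sq, sq_abs]
      _ ≤ C * (C * Real.exp (-k * |y|)) := mul_le_mul h2 h1 (abs_nonneg _) hC
      _ = C ^ 2 * Real.exp (-k * |y|) := by ring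
  have iW := kato_integrableOn_weight' hk hC L
  have ik := kato_integrableOn_weight hk L
  have hE₁b : E₁ ≤ D ^ 2 * C ^ 2 * Ik := by
    simp only [hE₁, hIk]; rw [← integral_const_mul]
    refine integral_mono iE₁ (ik.const_mul _) fun q => ?_
    simp only
    have h1 := hω2b q.1 q.2; have h2 := hψ'b q.2
    have h3 : deriv ψ q.2 ^ 2 ≤ D ^ 2 := by
      rw [← sq_abs]; exact pow_le_pow_left₀ (abs_nonneg _) h2 2
    calc ω q.1 q.2 ^ 2 * deriv ψ q.2 ^ 2 ≤ C ^ 2 * Real.exp (-k * |q.2|) * D ^ 2 :=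
          mul_le_mul h1 h3 (sq_nonneg _) (by positivity)
      _ = D ^ 2 * C ^ 2 * Real.exp (-k * |q.2|) := by ring
  have hE₂b : |E₂| ≤ 2 * D * C ^ 2 * IW := by
    simp only [hE₂, hIW]; rw [← integral_const_mul]
    have i2 : IntegrableOn (fun q : ℝ × ℝ => ω q.1 q.2 ^ 2 * (v t q.1 q.2 - q.2) * (2 * ψ q.2 * deriv ψ q.2))
        (Ioc 0 L ×ˢ univ) := by
      have := iψ' (fun q => ω q.1 q.2 ^ 2 * (v t q.1 q.2 - q.2) * (2 * ψ q.2)) (by fun_prop)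
      exact this.congr_fun (fun q _ => by simp only; ring) (measurableSet_Ioc.prod MeasurableSet.univ)
    refine (abs_integral_le_integral_abs.trans (integral_mono i2.abs (iW.const_mul _) fun q => ?_))
    simp only
    have h1 := hω2b q.1 q.2; have h2 := hψ'b q.2; have h3 := hψ1 q.2
    have hvy : |v t q.1 q.2 - q.2| ≤ C + |q.2| := by
      have := hT.abs_v_le_const hk q.1 q.2
      calc |v t q.1 q.2 - q.2| ≤ |v t q.1 q.2| + |q.2| := abs_sub _ _
        _ ≤ C + |q.2| := by linarith
    rw [abs_mul, abs_mul, abs_mul, abs_mul, abs_two, abs_of_nonneg (sq_nonneg _)]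
    calc ω q.1 q.2 ^ 2 * |v t q.1 q.2 - q.2| * (2 * |ψ q.2| * |deriv ψ q.2|) ≤
        C ^ 2 * Real.exp (-k * |q.2|) * (C + |q.2|) * (2 * 1 * D) := by
          refine mul_le_mul (mul_le_mul h1 hvy (abs_nonneg _) (by positivity)) ?_ (by positivity) (by positivity)
          exact mul_le_mul (by linarith) h2 (abs_nonneg _) (by norm_num)
      _ = 2 * D * C ^ 2 * ((C + |q.2|) * Real.exp (-k * |q.2|)) := by ring
  have hE₃b : |E₃| ≤ 2 * D * C ^ 2 * Ik := by
    simp only [hE₃, hIk]; rw [← integral_const_mul]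
    have i3 : IntegrableOn (fun q : ℝ × ℝ => ω q.1 q.2 * dY ω q.1 q.2 * (2 * ψ q.2 * deriv ψ q.2)) (Ioc 0 L ×ˢ univ) := by
      have := iψ' (fun q => ω q.1 q.2 * dY ω q.1 q.2 * (2 * ψ q.2)) (by fun_prop)
      exact this.congr_fun (fun q _ => by simp only; ring) (measurableSet_Ioc.prod MeasurableSet.univ)
    refine (abs_integral_le_integral_abs.trans (integral_mono i3.abs (ik.const_mul _) fun q => ?_))
    simp only
    have h1 := hωb q.1 q.2; have h1' := hωyb q.1 q.2; have h2 := hψ'b q.2; have h3 := hψ1 q.2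
    have h4 : |ω q.1 q.2| ≤ C := h1.trans (by nlinarith [hle1 q.2])
    rw [abs_mul, abs_mul, abs_mul, abs_mul, abs_two]
    calc |ω q.1 q.2| * |dY ω q.1 q.2| * (2 * |ψ q.2| * |deriv ψ q.2|) ≤ C * (C * Real.exp (-k * |q.2|)) * (2 * 1 * D) := by
          refine mul_le_mul (mul_le_mul h4 h1' (abs_nonneg _) hC) ?_ (by positivity) (by positivity)
          exact mul_le_mul (by linarith) h2 (abs_nonneg _) (by norm_num)
      _ = 2 * D * C ^ 2 * Real.exp (-k * |q.2|) := by ring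
  -- assemble
  rw [eF]
  have hE₂' : E₂ ≤ 2 * D * C ^ 2 * IW := (le_abs_self _).trans hE₂b
  have hE₃' : -E₃ ≤ 2 * D * C ^ 2 * Ik := (neg_le_abs _).trans hE₃b
  have hPt' : -(2 * ν) * Pt ≤ -ν * Pf + 2 * ν * E₁ := by nlinarith [hPf_le, hν]
  nlinarith [hE₂', mul_le_mul_of_nonneg_left hE₃' (by positivity : 0 ≤ 2 * ν),
    mul_le_mul_of_nonneg_left hE₁b (by positivity : 0 ≤ 2 * ν), hPt', hν, sq_nonneg C]

end EnstrophySlice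

end Summit.AnomalousDissipation.AnomalousDissipation.Theorems.StrainedLayerLaw.StrainWorkSumRule

end
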